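import Mathlib.Data.Finset.Powerset
import Mathlib.Algebra.BigOperators.Group.Finset.Powerset
import Mathlib.Algebra.BigOperators.Ring.Finset
import Mathlib.Algebra.Order.BigOperators.Group.Finset
import Mathlib.Order.WithBot
import HarnessLib

/-!
# `NoHeavyLowerTail` (crux stmt-CriticalPhenomena-4575), hull-port line hp-7: the COEFFICIENTWISE STRONG HARRIS–KLEITMAN inequality
# (Gladkov's inequality holds fibrewise, for complementary pairs)

Support file (prover `prim-hp-7`, generation 46; `--supports stmt-CriticalPhenomena-4575`).  Pure finite combinatorics, no definitions,
no `sorry`, standard axioms.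

THE MATHEMATICS (memo `prim-hp-7/FROM-prim-hp-7-g46-EXPORTS-FREE.md` §4.5).  Gladkov [arXiv:2305.02653 = Bull. LMS 2024, Thm 2.1] proved the
"strong Harris–Kleitman inequality": for a product measure on a hypercube partitioned as `A ⊔ C₁ ⊔ … ⊔ C_k ⊔ B` with every `A ∪ C_i`
up-closed, `μ(A)μ(B) ≥ Σ_{i<j} μ(C_i)μ(C_j)`; for the five connection patterns of three vertices it is the Aas–Gladkov inequality
`P(abc)P(a|b|c) ≥ P(ab|c)P(ac|b) + P(ab|c)P(a|bc) + P(ac|b)P(a|bc)` (= Harris + van den Berg–Kahn at once).  This file proves the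
COEFFICIENTWISE (fibre) version: encode the partition by a labelling `f` of the subsets of a finite set `F` with values in
`WithBot (WithTop ι)` — `⊥` = the class `B`, `↑↑i` = the middle class `C_i`, `↑⊤` = the class `A` — that along every inclusion `s ⊆ t ⊆ F`
either keeps the label, or leaves `⊥`, or arrives at `↑⊤` (this is exactly "every `A ∪ C_i` is up-closed").  Then among the complementary
pairs `(ζ, F \ ζ)`, those carrying two DISTINCT MIDDLE labels are at most as many as those carrying the labels `↑⊤` and `⊥`
(`card_filter_midPair_le_card_filter_topBot`).  Weighted by the Bernstein monomials and summed over all minors this is Gladkov's theorem;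
for two middle classes it is the tree lemma `JBern.card_sdiff_inter_compls_sdiff_le`; for the percolation patterns of a fibre minor it is
the row `N(T,PM) ≥ N(O′,E) + N(E,PV) + N(PV,O′)` of the J-BERN⁺ fibre analysis, which lies outside the weighted-Harris cone.
PROOF (shorter than the original): with the signed weight `g(a,b) = [ {a,b} = {↑⊤,⊥} ] − [ a, b distinct middles ]` the signed count over
`(insert e F′).powerset` is the sum over the two MIXED complementary pairings of `F′`, and the pointwise exchange inequality
`g u₁ v₁ + g u₂ v₂ ≤ g u₁ v₂ + g u₂ v₁` for allowed transitions `u₁ → u₂`, `v₁ → v₂` (`exchange`) bounds it below by the two PURE pairings,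
i.e. by the induction hypothesis for `f` and for `f ∘ insert e`. [this work]
-/

namespace Summit.CriticalPhenomena.PercolationContinuityZ3.Theorems.JBern

open Finset

variable {α : Type*} [DecidableEq α] {ι : Type*} [DecidableEq ι]

omit [DecidableEq α] [DecidableEq ι] in
/-- Every label is `⊥`, `((⊤ : WithTop ι) : WithBot (WithTop ι))`, or a middle label `↑↑i`. [this work] -/
theorem label_trichotomy (a : WithBot (WithTop ι)) :
    a = ⊥ ∨ a = ((⊤ : WithTop ι) : WithBot (WithTop ι)) ∨ ∃ i : ι, a = ((i : WithTop ι) : WithBot (WithTop ι)) := by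
  induction a using WithBot.recBotCoe with
  | bot => exact Or.inl rfl
  | coe a =>
    induction a using WithTop.recTopCoe with
    | top => exact Or.inr (Or.inl rfl)
    | coe i => exact Or.inr (Or.inr ⟨i, rfl⟩)

omit [DecidableEq α] in
/-- **Exchange inequality** (the whole induction step).  For labels `u₁ → u₂` and `v₁ → v₂` making allowed transitions (equal, or from `⊥`,
or to `((⊤ : WithTop ι) : WithBot (WithTop ι))`): `g u₁ v₁ + g u₂ v₂ ≤ g u₁ v₂ + g u₂ v₁` for the signed pair weight `g`. [this work] -/
theorem exchange (u₁ u₂ v₁ v₂ : WithBot (WithTop ι))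
    (hu : u₁ = u₂ ∨ u₁ = ⊥ ∨ u₂ = ((⊤ : WithTop ι) : WithBot (WithTop ι))) (hv : v₁ = v₂ ∨ v₁ = ⊥ ∨ v₂ = ((⊤ : WithTop ι) : WithBot (WithTop ι))) :
    ((if (u₁ = ((⊤ : WithTop ι) : WithBot (WithTop ι)) ∧ v₁ = (⊥ : WithBot (WithTop ι))) ∨ (u₁ = (⊥ : WithBot (WithTop ι)) ∧ v₁ = ((⊤ : WithTop ι) : WithBot (WithTop ι))) then (1 : ℤ) else 0) - (if u₁ ≠ (⊥ : WithBot (WithTop ι)) ∧ u₁ ≠ ((⊤ : WithTop ι) : WithBot (WithTop ι)) ∧ v₁ ≠ (⊥ : WithBot (WithTop ι)) ∧ v₁ ≠ ((⊤ : WithTop ι) : WithBot (WithTop ι)) ∧ u₁ ≠ v₁ then (1 : ℤ) else 0)) + ((if (u₂ = ((⊤ : WithTop ι) : WithBot (WithTop ι)) ∧ v₂ = (⊥ : WithBot (WithTop ι))) ∨ (u₂ = (⊥ : WithBot (WithTop ι)) ∧ v₂ = ((⊤ : WithTop ι) : WithBot (WithTop ι))) then (1 : ℤ) else 0) - (if u₂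 ≠ (⊥ : WithBot (WithTop ι)) ∧ u₂ ≠ ((⊤ : WithTop ι) : WithBot (WithTop ι)) ∧ v₂ ≠ (⊥ : WithBot (WithTop ι)) ∧ v₂ ≠ ((⊤ : WithTop ι) : WithBot (WithTop ι)) ∧ u₂ ≠ v₂ then (1 : ℤ) else 0)) ≤ ((if (u₁ = ((⊤ : WithTop ι) : WithBot (WithTop ι)) ∧ v₂ = (⊥ : WithBot (WithTop ι))) ∨ (u₁ = (⊥ : WithBot (WithTop ι)) ∧ v₂ = ((⊤ : WithTop ι) : WithBot (WithTop ι))) then (1 : ℤ) else 0) - (if u₁ ≠ (⊥ : WithBot (WithTop ι)) ∧ u₁ ≠ ((⊤ : WithTop ι) : WithBot (WithTop ι)) ∧ v₂ ≠ (⊥ : WithBot (WithTop ι)) ∧ v₂ ≠ ((⊤ : WithTop ι) : WithBot (WithTop ι)) ∧ u₁ ≠ v₂ then (1 : ℤ) else 0)) + ((if (u₂ = ((⊤ : WithTop ι) : WithBot (WithTop ι)) ∧ v₁ = (⊥ : WithBot (WithTop ι))) ∨ (u₂ = (⊥ : WithBot (WithTop ι)) ∧ v₁ = ((⊤ : WithTop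 ι) : WithBot (WithTop ι))) then (1 : ℤ) else 0) - (if u₂ ≠ (⊥ : WithBot (WithTop ι)) ∧ u₂ ≠ ((⊤ : WithTop ι) : WithBot (WithTop ι)) ∧ v₁ ≠ (⊥ : WithBot (WithTop ι)) ∧ v₁ ≠ ((⊤ : WithTop ι) : WithBot (WithTop ι)) ∧ u₂ ≠ v₁ then (1 : ℤ) else 0)) := by
  have hbt : (⊥ : WithBot (WithTop ι)) ≠ ⊤ := by rw [← WithBot.coe_top]; exact WithBot.bot_ne_coe
  have htb : (⊤ : WithBot (WithTop ι)) ≠ ⊥ := by rw [← WithBot.coe_top]; exact WithBot.coe_ne_bot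
  rcases hu with rfl | rfl | rfl <;> rcases hv with rfl | rfl | rfl
  · exact le_rfl
  · exact le_of_eq (add_comm _ _)
  · exact le_of_eq (add_comm _ _)
  · exact le_rfl
  · -- u₁ = ⊥, v₁ = ⊥ : free u₂, v₂
    rcases label_trichotomy u₂ with rfl | rfl | ⟨i, rfl⟩ <;> rcases label_trichotomy v₂ with rfl | rfl | ⟨k, rfl⟩ <;>
      simp [WithTop.coe_ne_top, WithTop.top_ne_coe, hbt, htb]
    all_goals omega
  · -- u₁ = ⊥, v₂ = ((⊤ : WithTop ι) : WithBot (WithTop ι)) : free u₂, v₁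
    rcases label_trichotomy u₂ with rfl | rfl | ⟨i, rfl⟩ <;> rcases label_trichotomy v₁ with rfl | rfl | ⟨k, rfl⟩ <;>
      simp [WithTop.coe_ne_top, WithTop.top_ne_coe, hbt, htb]
    all_goals omega
  · exact le_rfl
  · -- u₂ = ((⊤ : WithTop ι) : WithBot (WithTop ι)), v₁ = ⊥ : free u₁, v₂
    rcases label_trichotomy u₁ with rfl | rfl | ⟨i, rfl⟩ <;> rcases label_trichotomy v₂ with rfl | rfl | ⟨k, rfl⟩ <;>
      simp [WithTop.coe_ne_top, WithTop.top_ne_coe, hbt, htb]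
    all_goals omega
  · -- u₂ = ((⊤ : WithTop ι) : WithBot (WithTop ι)), v₂ = ((⊤ : WithTop ι) : WithBot (WithTop ι)) : free u₁, v₁
    rcases label_trichotomy u₁ with rfl | rfl | ⟨i, rfl⟩ <;> rcases label_trichotomy v₁ with rfl | rfl | ⟨k, rfl⟩ <;>
      simp [WithTop.coe_ne_top, WithTop.top_ne_coe, hbt, htb]
    all_goals omega

/-- **Signed form of the coefficientwise strong Harris–Kleitman inequality.**  For a labelling `f` of the subsets of `F` by
`⊥ / ↑↑i / ((⊤ : WithTop ι) : WithBot (WithTop ι))` that makes only allowed transitions along inclusions inside `F`, the signed count `Σ_{ζ ⊆ F} g (f ζ) (f (F \ ζ))`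
is nonnegative.  Induction on `F`: over `(insert e F′).powerset` the complementary pairs are the two MIXED pairings `(η, insert e (F′\η))`,
`(insert e η, F′\η)` of `F′`; `exchange` bounds their weight below by the two PURE pairings, i.e. by the sums for `f` and `f ∘ insert e`
on `F′`. [this work] -/
theorem sum_pairWeight_compl_nonneg (F : Finset α) (f : Finset α → WithBot (WithTop ι))
    (hf : ∀ s t : Finset α, s ⊆ t → t ⊆ F → (f s = f t ∨ f s = ⊥ ∨ f t = ((⊤ : WithTop ι) : WithBot (WithTop ι)))) :
    0 ≤ ∑ ζ ∈ F.powerset, ((if ((f ζ) = ((⊤ : WithTop ι) : WithBot (WithTop ι)) ∧ (f (F \ ζ)) = (⊥ : WithBot (WithTop ι))) ∨ ((f ζ) = (⊥ : WithBot (WithTop ι)) ∧ (f (F \ ζ)) = ((⊤ : WithTop ι) : WithBot (WithTop ι))) then (1 : ℤ) else 0) - (if (f ζ) ≠ (⊥ : WithBot (WithTop ι)) ∧ (f ζ) ≠ ((⊤ : WithTop ι) : WithBot (WithTop ι)) ∧ (f (F \ ζ)) ≠ (⊥ : WithBot (WithTop ι)) ∧ (f (F \ ζ)) ≠ ((⊤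 : WithTop ι) : WithBot (WithTop ι)) ∧ (f ζ) ≠ (f (F \ ζ)) then (1 : ℤ) else 0)) := by
  induction F using Finset.induction_on generalizing f with
  | empty =>
    rw [Finset.powerset_empty, Finset.sum_singleton, Finset.sdiff_self]
    have hm : ¬ (f ∅ ≠ ⊥ ∧ f ∅ ≠ ((⊤ : WithTop ι) : WithBot (WithTop ι)) ∧ f ∅ ≠ ⊥ ∧ f ∅ ≠ ((⊤ : WithTop ι) : WithBot (WithTop ι)) ∧ f ∅ ≠ f ∅) := fun h => h.2.2.2.2 rfl
    rw [if_neg hm, sub_zero]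
    split_ifs <;> omega
  | insert e F' he ih =>
    rw [Finset.sum_powerset_insert he]
    have h1 : ∀ η ∈ F'.powerset, ((if ((f η) = ((⊤ : WithTop ι) : WithBot (WithTop ι)) ∧ (f (insert e F' \ η)) = (⊥ : WithBot (WithTop ι))) ∨ ((f η) = (⊥ : WithBot (WithTop ι)) ∧ (f (insert e F' \ η)) = ((⊤ : WithTop ι) : WithBot (WithTop ι))) then (1 : ℤ) else 0) - (if (f η) ≠ (⊥ : WithBot (WithTop ι)) ∧ (f η) ≠ ((⊤ : WithTop ι) : WithBot (WithTop ι)) ∧ (f (insert e F' \ η)) ≠ (⊥ : WithBot (WithTop ι)) ∧ (f (insert e F' \ η)) ≠ ((⊤ : WithTop ι) : WithBot (WithTop ι)) ∧ (f η) ≠ (f (insert e F' \ η)) then (1 : ℤ) else 0)) = ((if ((f η) = ((⊤ : WithTop ι) : WithBot (WithTop ι)) ∧ (f (insert e (F' \ η))) = (⊥ : WithBot (WithTop ι))) ∨ ((f η) = (⊥ : WithBot (WithTop ι)) ∧ (f (insert e (F' \ η))) = ((⊤ : WithTop ι) : WithBot (WithTop ι))) then (1 : ℤ) else 0) - (if (f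 η) ≠ (⊥ : WithBot (WithTop ι)) ∧ (f η) ≠ ((⊤ : WithTop ι) : WithBot (WithTop ι)) ∧ (f (insert e (F' \ η))) ≠ (⊥ : WithBot (WithTop ι)) ∧ (f (insert e (F' \ η))) ≠ ((⊤ : WithTop ι) : WithBot (WithTop ι)) ∧ (f η) ≠ (f (insert e (F' \ η))) then (1 : ℤ) else 0)) := by
      intro η hη
      rw [Finset.mem_powerset] at hη
      have : e ∉ η := fun h => he (hη h)
      rw [Finset.insert_sdiff_of_notMem _ this]
    have h2 : ∀ η ∈ F'.powerset, ((if ((f (insert e η)) = ((⊤ : WithTop ι) : WithBot (WithTop ι)) ∧ (f (insert e F' \ insert e η)) = (⊥ : WithBot (WithTop ι))) ∨ ((f (insert e η)) = (⊥ : WithBot (WithTop ι)) ∧ (f (insert e F' \ insert e η)) = ((⊤ : WithTop ι) : WithBot (WithTop ι))) then (1 : ℤ) else 0) - (if (f (insert e η)) ≠ (⊥ : WithBot (WithTop ι)) ∧ (f (insert e η)) ≠ ((⊤ : WithTop ι) : WithBot (WithTop ι)) ∧ (f (insert e F' \ insert e η)) ≠ (⊥ : WithBot (WithTop ι)) ∧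 (f (insert e F' \ insert e η)) ≠ ((⊤ : WithTop ι) : WithBot (WithTop ι)) ∧ (f (insert e η)) ≠ (f (insert e F' \ insert e η)) then (1 : ℤ) else 0)) = ((if ((f (insert e η)) = ((⊤ : WithTop ι) : WithBot (WithTop ι)) ∧ (f (F' \ η)) = (⊥ : WithBot (WithTop ι))) ∨ ((f (insert e η)) = (⊥ : WithBot (WithTop ι)) ∧ (f (F' \ η)) = ((⊤ : WithTop ι) : WithBot (WithTop ι))) then (1 : ℤ) else 0) - (if (f (insert e η)) ≠ (⊥ : WithBot (WithTop ι)) ∧ (f (insert e η)) ≠ ((⊤ : WithTop ι) : WithBot (WithTop ι)) ∧ (f (F' \ η)) ≠ (⊥ : WithBot (WithTop ι)) ∧ (f (F' \ η)) ≠ ((⊤ : WithTop ι) : WithBot (WithTop ι)) ∧ (f (insert e η)) ≠ (f (F' \ η)) then (1 : ℤ) else 0)) := by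
      intro η _
      rw [Finset.insert_sdiff_of_mem _ (Finset.mem_insert_self e η), Finset.sdiff_insert_of_notMem he _]
    rw [Finset.sum_congr rfl h1, Finset.sum_congr rfl h2, ← Finset.sum_add_distrib]
    have ih0 : 0 ≤ ∑ η ∈ F'.powerset, ((if ((f η) = ((⊤ : WithTop ι) : WithBot (WithTop ι)) ∧ (f (F' \ η)) = (⊥ : WithBot (WithTop ι))) ∨ ((f η) = (⊥ : WithBot (WithTop ι)) ∧ (f (F' \ η)) = ((⊤ : WithTop ι) : WithBot (WithTop ι))) then (1 : ℤ) else 0) - (if (f η) ≠ (⊥ : WithBot (WithTop ι)) ∧ (f η) ≠ ((⊤ : WithTop ι) : WithBot (WithTop ι)) ∧ (f (F' \ η)) ≠ (⊥ : WithBot (WithTop ι)) ∧ (f (F' \ η)) ≠ ((⊤ : WithTop ι) : WithBot (WithTop ι)) ∧ (f η) ≠ (f (F' \ η)) then (1 : ℤ) else 0)) :=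
      ih f (fun s t hst ht => hf s t hst (ht.trans (Finset.subset_insert e F')))
    have ih1 : 0 ≤ ∑ η ∈ F'.powerset, ((if ((f (insert e η)) = ((⊤ : WithTop ι) : WithBot (WithTop ι)) ∧ (f (insert e (F' \ η))) = (⊥ : WithBot (WithTop ι))) ∨ ((f (insert e η)) = (⊥ : WithBot (WithTop ι)) ∧ (f (insert e (F' \ η))) = ((⊤ : WithTop ι) : WithBot (WithTop ι))) then (1 : ℤ) else 0) - (if (f (insert e η)) ≠ (⊥ : WithBot (WithTop ι)) ∧ (f (insert e η)) ≠ ((⊤ : WithTop ι) : WithBot (WithTop ι)) ∧ (f (insert e (F' \ η))) ≠ (⊥ : WithBot (WithTop ι)) ∧ (f (insert e (F' \ η))) ≠ ((⊤ : WithTop ι) : WithBot (WithTop ι)) ∧ (f (insert e η)) ≠ (f (insert e (F' \ η))) then (1 : ℤ) else 0)) :=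
      ih (fun s => f (insert e s))
        (fun s t hst ht => hf _ _ (Finset.insert_subset_insert e hst) (Finset.insert_subset_insert e ht))
    have hpt : ∀ η ∈ F'.powerset,
        ((if ((f η) = ((⊤ : WithTop ι) : WithBot (WithTop ι)) ∧ (f (F' \ η)) = (⊥ : WithBot (WithTop ι))) ∨ ((f η) = (⊥ : WithBot (WithTop ι)) ∧ (f (F' \ η)) = ((⊤ : WithTop ι) : WithBot (WithTop ι))) then (1 : ℤ) else 0) - (if (f η) ≠ (⊥ : WithBot (WithTop ι)) ∧ (f η) ≠ ((⊤ : WithTop ι) : WithBot (WithTop ι)) ∧ (f (F' \ η)) ≠ (⊥ : WithBot (WithTop ι)) ∧ (f (F' \ η)) ≠ ((⊤ : WithTop ι) : WithBot (WithTop ι)) ∧ (f η) ≠ (f (F' \ η)) then (1 : ℤ) else 0)) + ((if ((f (insert e η)) = ((⊤ : WithTop ι) : WithBot (WithTop ι)) ∧ (f (insert e (F' \ η))) = (⊥ : WithBot (WithTop ι))) ∨ ((f (insert e η)) = (⊥ : WithBot (WithTop ι)) ∧ (f (insert e (F' \ η))) = ((⊤ : WithTop ι) : WithBot (WithTop ι)))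 then (1 : ℤ) else 0) - (if (f (insert e η)) ≠ (⊥ : WithBot (WithTop ι)) ∧ (f (insert e η)) ≠ ((⊤ : WithTop ι) : WithBot (WithTop ι)) ∧ (f (insert e (F' \ η))) ≠ (⊥ : WithBot (WithTop ι)) ∧ (f (insert e (F' \ η))) ≠ ((⊤ : WithTop ι) : WithBot (WithTop ι)) ∧ (f (insert e η)) ≠ (f (insert e (F' \ η))) then (1 : ℤ) else 0)) ≤
          ((if ((f η) = ((⊤ : WithTop ι) : WithBot (WithTop ι)) ∧ (f (insert e (F' \ η))) = (⊥ : WithBot (WithTop ι))) ∨ ((f η) = (⊥ : WithBot (WithTop ι)) ∧ (f (insert e (F' \ η))) = ((⊤ : WithTop ι) : WithBot (WithTop ι))) then (1 : ℤ) else 0) - (if (f η) ≠ (⊥ : WithBot (WithTop ι)) ∧ (f η) ≠ ((⊤ : WithTop ι) : WithBot (WithTop ι)) ∧ (f (insert e (F' \ η))) ≠ (⊥ : WithBot (WithTop ι)) ∧ (f (insert e (F' \ η))) ≠ ((⊤ : WithTop ι) : WithBot (WithTop ι)) ∧ (f η) ≠ (f (insert e (F' \ η))) then (1 : ℤ) else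 0)) + ((if ((f (insert e η)) = ((⊤ : WithTop ι) : WithBot (WithTop ι)) ∧ (f (F' \ η)) = (⊥ : WithBot (WithTop ι))) ∨ ((f (insert e η)) = (⊥ : WithBot (WithTop ι)) ∧ (f (F' \ η)) = ((⊤ : WithTop ι) : WithBot (WithTop ι))) then (1 : ℤ) else 0) - (if (f (insert e η)) ≠ (⊥ : WithBot (WithTop ι)) ∧ (f (insert e η)) ≠ ((⊤ : WithTop ι) : WithBot (WithTop ι)) ∧ (f (F' \ η)) ≠ (⊥ : WithBot (WithTop ι)) ∧ (f (F' \ η)) ≠ ((⊤ : WithTop ι) : WithBot (WithTop ι)) ∧ (f (insert e η)) ≠ (f (F' \ η)) then (1 : ℤ) else 0)) := by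
      intro η hη
      rw [Finset.mem_powerset] at hη
      refine exchange (f η) (f (insert e η)) (f (F' \ η)) (f (insert e (F' \ η))) ?_ ?_
      · exact hf _ _ (Finset.subset_insert e η) (Finset.insert_subset_insert e hη)
      · exact hf _ _ (Finset.subset_insert e _) (Finset.insert_subset_insert e Finset.sdiff_subset)
    calc (0 : ℤ) ≤ ∑ η ∈ F'.powerset, ((if ((f η) = ((⊤ : WithTop ι) : WithBot (WithTop ι)) ∧ (f (F' \ η)) = (⊥ : WithBot (WithTop ι))) ∨ ((f η) = (⊥ : WithBot (WithTop ι)) ∧ (f (F' \ η)) = ((⊤ : WithTop ι) : WithBot (WithTop ι))) then (1 : ℤ) else 0) - (if (f η) ≠ (⊥ : WithBot (WithTop ι)) ∧ (f η) ≠ ((⊤ : WithTop ι) : WithBot (WithTop ι)) ∧ (f (F' \ η)) ≠ (⊥ : WithBot (WithTop ι)) ∧ (f (F' \ η)) ≠ ((⊤ : WithTop ι) : WithBot (WithTop ι)) ∧ (f η) ≠ (f (F' \ η)) then (1 : ℤ) else 0)) + ∑ η ∈ F'.powerset, ((if ((f (insert e η)) = ((⊤ : WithTop ι) : WithBot (WithTop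 ι)) ∧ (f (insert e (F' \ η))) = (⊥ : WithBot (WithTop ι))) ∨ ((f (insert e η)) = (⊥ : WithBot (WithTop ι)) ∧ (f (insert e (F' \ η))) = ((⊤ : WithTop ι) : WithBot (WithTop ι))) then (1 : ℤ) else 0) - (if (f (insert e η)) ≠ (⊥ : WithBot (WithTop ι)) ∧ (f (insert e η)) ≠ ((⊤ : WithTop ι) : WithBot (WithTop ι)) ∧ (f (insert e (F' \ η))) ≠ (⊥ : WithBot (WithTop ι)) ∧ (f (insert e (F' \ η))) ≠ ((⊤ : WithTop ι) : WithBot (WithTop ι)) ∧ (f (insert e η)) ≠ (f (insert e (F' \ η))) then (1 : ℤ) else 0)) :=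
          add_nonneg ih0 ih1
      _ = ∑ η ∈ F'.powerset, (((if ((f η) = ((⊤ : WithTop ι) : WithBot (WithTop ι)) ∧ (f (F' \ η)) = (⊥ : WithBot (WithTop ι))) ∨ ((f η) = (⊥ : WithBot (WithTop ι)) ∧ (f (F' \ η)) = ((⊤ : WithTop ι) : WithBot (WithTop ι))) then (1 : ℤ) else 0) - (if (f η) ≠ (⊥ : WithBot (WithTop ι)) ∧ (f η) ≠ ((⊤ : WithTop ι) : WithBot (WithTop ι)) ∧ (f (F' \ η)) ≠ (⊥ : WithBot (WithTop ι)) ∧ (f (F' \ η)) ≠ ((⊤ : WithTop ι) : WithBot (WithTop ι)) ∧ (f η) ≠ (f (F' \ η)) then (1 : ℤ) else 0)) + ((if ((f (insert e η)) = ((⊤ : WithTop ι) : WithBot (WithTop ι)) ∧ (f (insert e (F' \ η))) = (⊥ : WithBot (WithTop ι))) ∨ ((f (insert e η)) = (⊥ : WithBot (WithTop ι)) ∧ (f (insert e (F' \ η))) = ((⊤ : WithTop ι) : WithBot (WithTop ι))) then (1 : ℤ) else 0) - (if (f (insert e η)) ≠ (⊥ : WithBot (WithTop ι)) ∧ (f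 (insert e η)) ≠ ((⊤ : WithTop ι) : WithBot (WithTop ι)) ∧ (f (insert e (F' \ η))) ≠ (⊥ : WithBot (WithTop ι)) ∧ (f (insert e (F' \ η))) ≠ ((⊤ : WithTop ι) : WithBot (WithTop ι)) ∧ (f (insert e η)) ≠ (f (insert e (F' \ η))) then (1 : ℤ) else 0))) :=
          Finset.sum_add_distrib.symm
      _ ≤ ∑ η ∈ F'.powerset, (((if ((f η) = ((⊤ : WithTop ι) : WithBot (WithTop ι)) ∧ (f (insert e (F' \ η))) = (⊥ : WithBot (WithTop ι))) ∨ ((f η) = (⊥ : WithBot (WithTop ι)) ∧ (f (insert e (F' \ η))) = ((⊤ : WithTop ι) : WithBot (WithTop ι))) then (1 : ℤ) else 0) - (if (f η) ≠ (⊥ : WithBot (WithTop ι)) ∧ (f η) ≠ ((⊤ : WithTop ι) : WithBot (WithTop ι)) ∧ (f (insert e (F' \ η))) ≠ (⊥ : WithBot (WithTop ι)) ∧ (f (insert e (F' \ η))) ≠ ((⊤ : WithTop ι) : WithBot (WithTop ι)) ∧ (f η) ≠ (f (insert e (F' \ η))) then (1 : ℤ) else 0)) + ((if ((f (insert e η))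 = ((⊤ : WithTop ι) : WithBot (WithTop ι)) ∧ (f (F' \ η)) = (⊥ : WithBot (WithTop ι))) ∨ ((f (insert e η)) = (⊥ : WithBot (WithTop ι)) ∧ (f (F' \ η)) = ((⊤ : WithTop ι) : WithBot (WithTop ι))) then (1 : ℤ) else 0) - (if (f (insert e η)) ≠ (⊥ : WithBot (WithTop ι)) ∧ (f (insert e η)) ≠ ((⊤ : WithTop ι) : WithBot (WithTop ι)) ∧ (f (F' \ η)) ≠ (⊥ : WithBot (WithTop ι)) ∧ (f (F' \ η)) ≠ ((⊤ : WithTop ι) : WithBot (WithTop ι)) ∧ (f (insert e η)) ≠ (f (F' \ η)) then (1 : ℤ) else 0))) :=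
          Finset.sum_le_sum hpt

/-- **Coefficientwise strong Harris–Kleitman inequality (counting form).**  Let `f` label the subsets of a finite set `F` by
`⊥` (class `B`), middle labels `↑↑i` (classes `C_i`) and `↑⊤` (class `A`), so that along every inclusion `s ⊆ t ⊆ F` the label is kept,
or `f s = ⊥`, or `f t = ↑⊤` (⇔ every `A ∪ C_i` is up-closed).  Then the complementary pairs `(ζ, F \ ζ)` whose two labels are DISTINCT
MIDDLE labels are at most as many as those whose labels are `{↑⊤, ⊥}`:
`#{ζ ⊆ F : f ζ, f (F\ζ) ∉ {⊥, ↑⊤}, f ζ ≠ f (F\ζ)} ≤ #{ζ ⊆ F : {f ζ, f (F\ζ)} = {↑⊤, ⊥}}`, i.e. `Σ_{i<j} N(C_i,C_j) ≤ N(A,B)` with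
`N(X,Y) = #{ζ : ζ ∈ X, F \ ζ ∈ Y}` (both sides count each unordered pair twice).  Gladkov's product-measure theorem is the Bernstein-weighted
sum of these counts over all minors; for the three-terminal percolation patterns: `N(T,PM) ≥ N(O′,E) + N(E,PV) + N(PV,O′)`. [this work] -/
theorem card_filter_midPair_le_card_filter_topBot (F : Finset α) (f : Finset α → WithBot (WithTop ι))
    (hf : ∀ s t : Finset α, s ⊆ t → t ⊆ F → (f s = f t ∨ f s = ⊥ ∨ f t = ((⊤ : WithTop ι) : WithBot (WithTop ι)))) :
    #(F.powerset.filter fun ζ =>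
        f ζ ≠ ⊥ ∧ f ζ ≠ ((⊤ : WithTop ι) : WithBot (WithTop ι)) ∧ f (F \ ζ) ≠ ⊥ ∧ f (F \ ζ) ≠ ((⊤ : WithTop ι) : WithBot (WithTop ι)) ∧ f ζ ≠ f (F \ ζ))
      ≤ #(F.powerset.filter fun ζ => (f ζ = ((⊤ : WithTop ι) : WithBot (WithTop ι)) ∧ f (F \ ζ) = ⊥) ∨ (f ζ = ⊥ ∧ f (F \ ζ) = ((⊤ : WithTop ι) : WithBot (WithTop ι)))) := by
  have h := sum_pairWeight_compl_nonneg F f hf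
  rw [Finset.sum_sub_distrib] at h
  have e1 : (∑ ζ ∈ F.powerset, if (f ζ = ((⊤ : WithTop ι) : WithBot (WithTop ι)) ∧ f (F \ ζ) = ⊥) ∨ (f ζ = ⊥ ∧ f (F \ ζ) = ((⊤ : WithTop ι) : WithBot (WithTop ι))) then (1 : ℤ) else 0) =
      (#(F.powerset.filter fun ζ => (f ζ = ((⊤ : WithTop ι) : WithBot (WithTop ι)) ∧ f (F \ ζ) = ⊥) ∨ (f ζ = ⊥ ∧ f (F \ ζ) = ((⊤ : WithTop ι) : WithBot (WithTop ι)))) : ℤ) := by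
    rw [Finset.natCast_card_filter]
  have e2 : (∑ ζ ∈ F.powerset, if f ζ ≠ ⊥ ∧ f ζ ≠ ((⊤ : WithTop ι) : WithBot (WithTop ι)) ∧ f (F \ ζ) ≠ ⊥ ∧ f (F \ ζ) ≠ ((⊤ : WithTop ι) : WithBot (WithTop ι)) ∧ f ζ ≠ f (F \ ζ) then (1 : ℤ) else 0) =
      (#(F.powerset.filter fun ζ => f ζ ≠ ⊥ ∧ f ζ ≠ ((⊤ : WithTop ι) : WithBot (WithTop ι)) ∧ f (F \ ζ) ≠ ⊥ ∧ f (F \ ζ) ≠ ((⊤ : WithTop ι) : WithBot (WithTop ι)) ∧ f ζ ≠ f (F \ ζ)) : ℤ) := by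
    rw [Finset.natCast_card_filter]
  rw [e1, e2] at h
  exact_mod_cast (sub_nonneg.1 h)

end Summit.CriticalPhenomena.PercolationContinuityZ3.Theorems.JBern
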